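import Mathlib
import Summits.QuantumFields.YangMills.Theses.SpecificationCompactness
import Literature.MathematicalPhysics.QuantumFieldTheory.Balaban1983to89.T3OrbitAverage

/-!
# `WeakLimitToLeaf` (route SpecificationCompactness, support r9, stmt-QuantumFields-28254) — PROVED

WEAK CONVERGENCE OF THE PRINTED UNIT LAWS GIVES THE LEAF CLAUSE: for every torus family `F` and `γ > 0`, if every CONTINUOUS function of
the unit-torus configuration has a limit of its integrals against the unit laws `unitLaw_K` of the printed averaging `expMeanLogSU`
(`K → ∞`), then `ContinuumYM3Torus F expMeanLogSU γ`.

Proof (bookkeeping over the tree): a joint expectation of unit-scale averaged loop variables IS the integral of a loop string against the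
unit law (`T3ThresholdRemoval.expectAt_eq_integral_unitLaw`); a loop string `u ↦ ∏_{C ∈ Cs} W_C(u)` is continuous (`T3OrbitAverage.continuous_loopAt`,
finite products); so `HasContinuumLimit (F.scheme expMeanLogSU γ)`, and on `SU(2)` that is the whole content of `ContinuumYM3Torus`
(`continuumYM3Torus_iff_hasContinuumLimit_SU`: uniqueness, RP and covariance outright).

HONEST FRAMING.  Conditional bookkeeping (rung R3 RECORD line): no weak convergence, no instance of `ContinuumYM3Torus` and nothing about
the YM mass gap is proved here.  Sources: [Balaban1985UV3] (1)–(3) p. 256 (the unit laws `ρ_K dV`), [JaffeWittenClay2006] §6.5 p. 11.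
-/

noncomputable section

namespace Summit.QuantumFields.YangMills.Theorems.SpecificationCompactnessWeakLimit

open MeasureTheory Filter Topology
open Literature.MathematicalPhysics.QuantumFieldTheory.Balaban1983to89
open Literature.MathematicalPhysics.QuantumFieldTheory.Balaban1983to89.T3ContinuumYM3Torus
open Literature.MathematicalPhysics.QuantumFieldTheory.Balaban1983to89.Missing
open Literature.MathematicalPhysics.QuantumFieldTheory.Balaban1983to89.T4Continuum
open Literature.MathematicalPhysics.QuantumFieldTheory.Balaban1983to89.T3ThresholdRemoval
open Literature.MathematicalPhysics.QuantumFieldTheory.Balaban1983to89.T3OrbitAverage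

/-- Products of a list of continuous real functions are continuous (local helper). [folklore] -/
private theorem continuous_list_prod {X : Type*} [TopologicalSpace X] {ι : Type*} (f : ι → X → ℝ)
    (hf : ∀ i, Continuous (f i)) : ∀ l : List ι, Continuous fun x => (l.map fun i => f i x).prod
  | [] => by simpa using continuous_const
  | i :: l => by
    show Continuous fun x => f i x * (l.map fun i => f i x).prod
    exact (hf i).mul (continuous_list_prod f hf l)

/-- A LOOP STRING `u ↦ ∏_{C ∈ Cs} W_C(u)` is a continuous function of the unit-torus configuration (`Re tr` of finite products of link
variables). [cite: Balaban1987RG1, (0.2) p.252] -/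
theorem continuous_loopString (F : T3Family) (Cs : List (ULoop3 F)) :
    Continuous fun u : GaugeField (F.P 0) 0 (Matrix.specialUnitaryGroup (Fin 2) ℂ) =>
      (Cs.map fun C => loopAt u (C.1.atLevel 0)).prod :=
  continuous_list_prod (fun (C : ULoop3 F) (u : GaugeField (F.P 0) 0 (Matrix.specialUnitaryGroup (Fin 2) ℂ)) =>
    loopAt u (C.1.atLevel 0)) (fun C => continuous_loopAt (C.1.atLevel 0)) Cs

/-- **WEAK CONVERGENCE OF THE UNIT LAWS ⇒ EXISTENCE OF THE CONTINUUM LIMIT OF ALL LOOP STRINGS**, for an ARBITRARY measurable small-loop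
average `ℰ` and `γ ≥ 0`: the joint expectations are integrals of continuous loop strings against the unit laws
(`expectAt_eq_integral_unitLaw`). [cite: JaffeWittenClay2006, §6.5 p.11] -/
theorem hasContinuumLimit_of_weakLimit (F : T3Family) (ℰ : LoopAverage (Matrix.specialUnitaryGroup (Fin 2) ℂ))
    (hE : ℰ.MeasurableE) {γ : ℝ} (hγ : 0 ≤ γ)
    (hweak : ∀ f : GaugeField (F.P 0) 0 (Matrix.specialUnitaryGroup (Fin 2) ℂ) → ℝ, Continuous f →
      ∃ l : ℝ, Tendsto (fun K : ℕ => ∫ V, f V ∂F.unitLaw ℰ hE γ K) atTop (𝓝 l)) :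
    HasContinuumLimit (F.scheme ℰ γ) := by
  intro Cs
  obtain ⟨l, hl⟩ := hweak _ (continuous_loopString F Cs)
  refine ⟨l, ?_⟩
  have hkey : (fun K => (F.scheme ℰ γ).expectAt K Cs) =
      fun K => ∫ u, (Cs.map fun C => loopAt u (C.1.atLevel 0)).prod ∂F.unitLaw ℰ hE γ K :=
    funext fun K => expectAt_eq_integral_unitLaw hE hγ K Cs
  rw [hkey]
  exact hl

/-- **`WeakLimitToLeaf` (route SpecificationCompactness, support r9, stmt-QuantumFields-28254) HOLDS**: weak convergence of the printed
unit laws (limits of `∫ f d(unitLaw_K)` for every continuous `f`) gives `ContinuumYM3Torus F expMeanLogSU γ` for every `γ > 0` — existence by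
`hasContinuumLimit_of_weakLimit`, and uniqueness / RP / covariance outright on `SU(2)` (`continuumYM3Torus_iff_hasContinuumLimit_SU`).
Rung R3 RECORD line; no summit statement is proved (the YM mass gap is NOT proved by any of this). [cite: JaffeWittenClay2006, §6.5 p.11] -/
theorem weakLimitToLeaf_proof : Summit.QuantumFields.YangMills.Theses.SpecificationCompactness.WeakLimitToLeaf := by
  intro F γ hγ hweak
  exact (continuumYM3Torus_iff_hasContinuumLimit_SU F _ T4ApexTwoLevel.measurableE_expMeanLogSU hγ.le).mpr
    (hasContinuumLimit_of_weakLimit F _ T4ApexTwoLevel.measurableE_expMeanLogSU hγ.le hweak)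

end Summit.QuantumFields.YangMills.Theorems.SpecificationCompactnessWeakLimit

end
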